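import Summits.CriticalPhenomena.Ising3D.TaylorRegionDeltaPieces
import Summits.CriticalPhenomena.Ising3D.TaylorRegionSplitEven
import Mathlib.Tactic.Linarith
import Mathlib.Tactic.Positivity
import Mathlib.Tactic.Ring
import HarnessLib

/-!
# The even region over a WIDE box: δ-expanded rows (bounded part) + the landed `(E, θ)` tails (item (L3b), even sector;
HOME/pub-ising3x-recog-1/gen12/REGION-ON-MARGIN-FUNCTIONAL.md §5)
(cell `pub-ising3x`, seat recog-1 gen 12; gate (g2))

HONEST FRAMING: lottery ticket; floor = tightest certified 3D Ising CFT bounds; no exact-solution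
claim without a proof. Island framing: certified exclusion region at stated derivative order and
assumptions; not a determination of the 3D Ising critical exponents beyond that.

`EvenRegionDataΔ`: a rational box `[σlo, σhi] × [εlo, εhi]`, the functional, and the parameters. The BOUNDED part
`E ∈ [E₀, E₁)` uses the δ-expanded row triples of `TaylorRegionDeltaRows` (component `X` around `σ₀` with half-width `Wσ`,
`Y` around `ε₀` / `Wε`, `Z = Z₃ + Z₄` around the mean `b₀` / `Wb`), producer LITERAL triples with per-row containment
(`rowLitOK`) and per-piece tests (`pieceOK`: `posOn3` for `X, Y`, `posOnDE3` for the discriminant); the TAIL `E ≥ E₁` reuses the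
landed split Booleans of `TaylorRegionSplitEven` on the box-enclosure tables (`toH`; MEASURED gen 12: the `(E, θ)` tails are
NOT box-width-limited at half-width 5e-4, unlike the landed rows). **`taylorEvenRegion_of_splitΔ`** assembles everything into
`TaylorEvenRegion (taylorCrossing ½ ½ l.toFinset c) (Icc σlo σhi ×ˢ Icc εlo εhi) E₀`. Elementary. [folklore]
-/

namespace Summit.CriticalPhenomena.Ising3D

open Finset Set
open Literature.Analysis.ValidatedNumerics Literature.Analysis.ValidatedNumerics.PolyMP
open Literature.Analysis.ValidatedNumerics.NumericsMP (MI)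
open Literature.MathematicalPhysics.QuantumFieldTheory.ConformalBootstrap3D

/-- `val3` is additive in the triple. [folklore] -/
theorem val3_add (a b : List ℝ × List ℝ × List ℝ) (x δ : ℝ) :
    val3 (addR a.1 b.1, addR a.2.1 b.2.1, addR a.2.2 b.2.2) x δ = val3 a x δ + val3 b x δ := by
  simp only [val3, evalR_addR]; ring

/-- Componentwise `subsetI` of triples. [folklore] -/
def subset3 (T L : ITriple) : Bool := subsetI T.1 L.1 && subsetI T.2.1 L.2.1 && subsetI T.2.2 L.2.2

/-- [folklore] -/
theorem pmem3_of_subset3 {S : ℕ} {r : List ℝ × List ℝ × List ℝ} {T L : ITriple} (h : PMem3 S r T)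
    (hs : subset3 T L = true) : PMem3 S r L := by
  simp only [subset3, Bool.and_eq_true] at hs
  exact ⟨pmem_of_subsetI h.fst hs.1.1, pmem_of_subsetI h.snd hs.1.2, pmem_of_subsetI h.thd hs.2⟩

/-- Componentwise sum of triples. [folklore] -/
def add3 (A B : ITriple) : ITriple := (addI A.1 B.1, addI A.2.1 B.2.1, addI A.2.2 B.2.2)

/-- The three real rows of a δ-table package as a `PMem3` (explicit shadows). [folklore] -/
theorem pmem3_delta_rows {S : ℕ} (hS : 0 < S) (cQ : ℕ × ℕ → ℚ) (σQ : ℚ) (s₀ : ℚ) {W : ℚ} (hW : 0 ≤ W) (ccQ : ℚ)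
    (l : List (ℕ × ℕ)) (N j : ℕ) {δ : ℝ} (hδ : |δ| ≤ W) :
    PMem3 S (qRowOfTable (deltaT0R cQ σQ s₀ ccQ l) N j, qRowOfTable (deltaT1R cQ σQ s₀ ccQ l) N j,
        qRowOfTable (deltaT2R cQ σQ s₀ ccQ l δ) N j)
      (qRowOfTableI (deltaT0 S cQ σQ s₀ ccQ l) N j, qRowOfTableI (deltaT1 S cQ σQ s₀ ccQ l) N j,
        qRowOfTableI (deltaT2 S cQ σQ s₀ W ccQ l) N j) :=
  ⟨(pmem_delta_rows hS cQ σQ s₀ hW ccQ l N j hδ).1, (pmem_delta_rows hS cQ σQ s₀ hW ccQ l N j hδ).2.1,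
    (pmem_delta_rows hS cQ σQ s₀ hW ccQ l N j hδ).2.2⟩

/-- `PMem3` of a componentwise sum. [folklore] -/
theorem pmem3_add {S : ℕ} {a b : List ℝ × List ℝ × List ℝ} {A B : ITriple} (ha : PMem3 S a A) (hb : PMem3 S b B) :
    PMem3 S (addR a.1 b.1, addR a.2.1 b.2.1, addR a.2.2 b.2.2) (add3 A B) :=
  ⟨pmem_addI ha.fst hb.fst, pmem_addI ha.snd hb.snd, pmem_addI ha.thd hb.thd⟩

/-- Data of a wide-box even-region certificate. `ccQ` serves the rows (keep `0`), `ccT` the tails. [folklore] -/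
structure EvenRegionDataΔ where
  S : ℕ
  l : List (ℕ × ℕ)
  cQ : Fin 5 → ℕ × ℕ → ℚ
  σlo : ℚ
  σhi : ℚ
  εlo : ℚ
  εhi : ℚ
  E0 : ℚ
  E1 : ℚ
  J1 : ℕ
  ccQ : ℚ
  ccT : ℚ
  N : ℕ
  R : ℕ
  prmX : HSParams
  prmY : HSParams
  prmD : HSParams
  dPj : ℕ

namespace EvenRegionDataΔ

variable (d : EvenRegionDataΔ)

/-- centres and half-widths -/
def σ0 : ℚ := (d.σlo + d.σhi) / 2
/-- [folklore] -/
def Wσ : ℚ := (d.σhi - d.σlo) / 2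
/-- [folklore] -/
def ε0 : ℚ := (d.εlo + d.εhi) / 2
/-- [folklore] -/
def Wε : ℚ := (d.εhi - d.εlo) / 2
/-- [folklore] -/
def b0 : ℚ := (d.σ0 + d.ε0) / 2
/-- [folklore] -/
def Wb : ℚ := (d.Wσ + d.Wε) / 2

/-- The landed hybrid data (box-enclosure tables) — used for the TAILS only. [folklore] -/
def toH : EvenRegionDataH where
  S := d.S
  l := d.l
  cQ := d.cQ
  sσI := enclQ d.S d.σlo d.σhi
  sεI := enclQ d.S d.εlo d.εhi
  sbI := enclQ d.S ((d.σlo + d.εlo) / 2) ((d.σhi + d.εhi) / 2)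
  E0 := d.E0
  E1 := d.E1
  J1 := d.J1
  ccQ := d.ccT
  N := d.N
  R := d.R
  prmX := d.prmX
  prmY := d.prmY
  prmD := d.prmD
  dPj := d.dPj

/-- computed row triples of the four components (δ-tables) -/
def RX (j : ℕ) : ITriple :=
  (qRowOfTableI (deltaT0 d.S (d.cQ 0) (-1) d.σ0 d.ccQ d.l) d.N j, qRowOfTableI (deltaT1 d.S (d.cQ 0) (-1) d.σ0 d.ccQ d.l) d.N j,
    qRowOfTableI (deltaT2 d.S (d.cQ 0) (-1) d.σ0 d.Wσ d.ccQ d.l) d.N j)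
/-- [folklore] -/
def RY (j : ℕ) : ITriple :=
  (qRowOfTableI (deltaT0 d.S (d.cQ 1) (-1) d.ε0 d.ccQ d.l) d.N j, qRowOfTableI (deltaT1 d.S (d.cQ 1) (-1) d.ε0 d.ccQ d.l) d.N j,
    qRowOfTableI (deltaT2 d.S (d.cQ 1) (-1) d.ε0 d.Wε d.ccQ d.l) d.N j)
/-- [folklore] -/
def RZ3 (j : ℕ) : ITriple :=
  (qRowOfTableI (deltaT0 d.S (d.cQ 3) (-1) d.b0 d.ccQ d.l) d.N j, qRowOfTableI (deltaT1 d.S (d.cQ 3) (-1) d.b0 d.ccQ d.l) d.N j,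
    qRowOfTableI (deltaT2 d.S (d.cQ 3) (-1) d.b0 d.Wb d.ccQ d.l) d.N j)
/-- [folklore] -/
def RZ4 (j : ℕ) : ITriple :=
  (qRowOfTableI (deltaT0 d.S (d.cQ 4) 1 d.b0 d.ccQ d.l) d.N j, qRowOfTableI (deltaT1 d.S (d.cQ 4) 1 d.b0 d.ccQ d.l) d.N j,
    qRowOfTableI (deltaT2 d.S (d.cQ 4) 1 d.b0 d.Wb d.ccQ d.l) d.N j)

/-- The default literal (empty triples). [folklore] -/
def noLit3 : ITriple × ITriple × ITriple := (([], [], []), ([], [], []), ([], [], []))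

/-- Containment of row `j`'s computed triples `X, Y, Z₃ + Z₄` in the producer literals `L[j] = (LX, LY, LZ)`. [folklore] -/
def rowLitOK (L : List (ITriple × ITriple × ITriple)) (j : ℕ) : Bool :=
  subset3 (d.RX j) (L.getD j noLit3).1 && subset3 (d.RY j) (L.getD j noLit3).2.1 &&
    subset3 (add3 (d.RZ3 j) (d.RZ4 j)) (L.getD j noLit3).2.2

/-- Left end of the `k`-th of `K` pieces of row `j`. [folklore] -/
def pieceLo (K j k : ℕ) : ℚ := (max d.E0 (j : ℚ) - d.ccQ) + (k : ℚ) * ((d.E1 - max d.E0 (j : ℚ)) / (K : ℚ))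

/-- ONE piece of row `j` on the literal triples. [folklore] -/
def pieceOK (L : List (ITriple × ITriple × ITriple)) (K j k : ℕ) : Bool :=
  decide (d.E1 < max d.E0 (j : ℚ)) ||
  (posOn3 d.S (L.getD j noLit3).1.1 (L.getD j noLit3).1.2.1 (L.getD j noLit3).1.2.2 d.Wσ d.dPj (d.pieceLo K j k)
      (d.pieceLo K j (k + 1)) &&
    posOn3 d.S (L.getD j noLit3).2.1.1 (L.getD j noLit3).2.1.2.1 (L.getD j noLit3).2.1.2.2 d.Wε d.dPj (d.pieceLo K j k)
      (d.pieceLo K j (k + 1)) &&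
    posOnDE3 d.S (L.getD j noLit3).1 (L.getD j noLit3).2.1 (L.getD j noLit3).2.2 d.Wσ d.Wε d.Wb d.dPj (d.pieceLo K j k)
      (d.pieceLo K j (k + 1)))

/-- Sizes: the landed sizes of the tail tables, the δ-table sizes, and a well-formed box. [folklore] -/
def sizesOK : Bool :=
  d.toH.sizesOK && decide (d.σlo ≤ d.σhi) && decide (d.εlo ≤ d.εhi) &&
  deltaSizeOK d.S (d.cQ 0) (-1) d.σ0 d.Wσ d.ccQ d.l d.N && deltaSizeOK d.S (d.cQ 1) (-1) d.ε0 d.Wε d.ccQ d.l d.N &&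
  deltaSizeOK d.S (d.cQ 3) (-1) d.b0 d.Wb d.ccQ d.l d.N && deltaSizeOK d.S (d.cQ 4) 1 d.b0 d.Wb d.ccQ d.l d.N

end EvenRegionDataΔ

/-- **The even region over a wide box** from the split Booleans: sizes, landed tails on the box-enclosure tables, per-row
containment of the δ-row triples in literals, per-piece triple tests. [folklore] -/
theorem taylorEvenRegion_of_splitΔ (d : EvenRegionDataΔ) (LT : IPoly2 × IPoly2 × IPoly2)
    (L : List (ITriple × ITriple × ITriple)) {K : ℕ} (hK : 0 < K) (hl : d.l.Nodup)
    (hs : d.sizesOK = true) (hLT : d.toH.tailLitOK LT = true) (hX : d.toH.tailXOKL LT = true)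
    (hY : d.toH.tailYOKL LT = true) (hD : ∀ k : ℕ, k < d.prmD.nθ → d.toH.tailDCellOKL LT k = true)
    (hr : ∀ j : ℕ, j < d.J1 + 1 → d.rowLitOK L j = true)
    (hpc : ∀ j k : ℕ, j < d.J1 + 1 → k < K → d.pieceOK L K j k = true) :
    TaylorEvenRegion (taylorCrossing (1 / 2) (1 / 2) d.l.toFinset fun i ab => (d.cQ i ab : ℝ))
      (Icc (d.σlo : ℝ) d.σhi ×ˢ Icc (d.εlo : ℝ) d.εhi) ((d.E0 : ℚ) : ℝ) := by
  simp only [EvenRegionDataΔ.sizesOK, EvenRegionDataH.sizesOK, Bool.and_eq_true, decide_eq_true_eq] at hs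
  obtain ⟨⟨⟨⟨⟨⟨⟨⟨⟨⟨⟨⟨⟨⟨⟨⟨⟨hS, hE0⟩, hJ1⟩, hR⟩, hN0⟩, hN1⟩, hN3⟩, hN4⟩, hθX⟩, hθY⟩, hθD⟩, hnD⟩, hσ⟩, hε⟩,
    hZX⟩, hZY⟩, hZ3⟩, hZ4⟩ := hs
  simp only [EvenRegionDataH.tailLitOK, Bool.and_eq_true] at hLT
  obtain ⟨⟨cX0, cY0⟩, cZ0⟩ := hLT
  -- normalise the `toH` projections to the fields of `d` (all definitional)
  have hS : 0 < d.S := hS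
  have hE0 : 0 < d.E0 := hE0
  have hJ1 : d.E1 ≤ (d.J1 : ℚ) + 1 := hJ1
  have hR : momLenOK d.N d.R = true := hR
  have hN0 : kernelSizeOK d.S (d.cQ 0) (-1) (enclQ d.S d.σlo d.σhi) d.ccT d.l d.N = true := hN0
  have hN1 : kernelSizeOK d.S (d.cQ 1) (-1) (enclQ d.S d.εlo d.εhi) d.ccT d.l d.N = true := hN1
  have hN3 : kernelSizeOK d.S (d.cQ 3) (-1) (enclQ d.S ((d.σlo + d.εlo) / 2) ((d.σhi + d.εhi) / 2)) d.ccT d.l d.N =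
      true := hN3
  have hN4 : kernelSizeOK d.S (d.cQ 4) 1 (enclQ d.S ((d.σlo + d.εlo) / 2) ((d.σhi + d.εhi) / 2)) d.ccT d.l d.N =
      true := hN4
  have hθX : 1 ≤ d.prmX.θhi := hθX
  have hθY : 1 ≤ d.prmY.θhi := hθY
  have hθD : 1 ≤ d.prmD.θhi := hθD
  have hnD : 0 < d.prmD.nθ := hnD
  have cX : subset2I (momTableI d.S (d.cQ 0) (-1) (enclQ d.S d.σlo d.σhi) d.ccT d.l d.N d.R) LT.1 = true := cX0
  have cY : subset2I (momTableI d.S (d.cQ 1) (-1) (enclQ d.S d.εlo d.εhi) d.ccT d.l d.N d.R) LT.2.1 = true := cY0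
  have cZ : subset2I (add2I (momTableI d.S (d.cQ 3) (-1) (enclQ d.S ((d.σlo + d.εlo) / 2) ((d.σhi + d.εhi) / 2))
      d.ccT d.l d.N d.R) (momTableI d.S (d.cQ 4) 1 (enclQ d.S ((d.σlo + d.εlo) / 2) ((d.σhi + d.εhi) / 2))
      d.ccT d.l d.N d.R)) LT.2.2 = true := cZ0
  have hDall : halfStripPosD d.S LT.1 LT.2.1 LT.2.2 (d.E1 - d.ccT) d.prmD = true :=
    halfStripPosD_of_cells (lt_of_lt_of_le zero_lt_one hθD) hnD hD
  have hWσ : 0 ≤ d.Wσ := by unfold EvenRegionDataΔ.Wσ; linarith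
  have hWε : 0 ≤ d.Wε := by unfold EvenRegionDataΔ.Wε; linarith
  have hWb : 0 ≤ d.Wb := by unfold EvenRegionDataΔ.Wb; linarith
  refine taylorEvenRegion_half_of_qRegion _ _ _ _ fun p hp E j hE hj => ?_
  obtain ⟨h1, h2, h3, h4⟩ : (d.σlo : ℝ) ≤ p.1 ∧ p.1 ≤ d.σhi ∧ (d.εlo : ℝ) ≤ p.2 ∧ p.2 ≤ d.εhi := by
    simp only [Set.mem_prod, Set.mem_Icc] at hp; exact ⟨hp.1.1, hp.1.2, hp.2.1, hp.2.2⟩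
  have hsσ : MI.mem d.S p.1 (enclQ d.S d.σlo d.σhi) := mem_enclQ _ h1 h2
  have hsε : MI.mem d.S p.2 (enclQ d.S d.εlo d.εhi) := mem_enclQ _ h3 h4
  have hsb : MI.mem d.S ((p.1 + p.2) / 2) (enclQ d.S ((d.σlo + d.εlo) / 2) ((d.σhi + d.εhi) / 2)) :=
    mem_enclQ _ (by push_cast; linarith) (by push_cast; linarith)
  have hEpos : 0 < E := lt_of_lt_of_le (by exact_mod_cast hE0) hE
  by_cases hE1 : ((d.E1 : ℚ) : ℝ) ≤ E
  · -- TAIL: the landed (E, θ) machinery on the box-enclosure tables (toH)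
    have hθ := div_mem_unit hEpos hj
    have hP : ((d.E1 - d.ccT : ℚ) : ℝ) ≤ E - d.ccT := by push_cast; linarith
    have eX := qSum_eq_eval2_momTable hS (d.cQ 0) (-1) hsσ d.ccT hl hN0 hR hEpos j
    have eY := qSum_eq_eval2_momTable hS (d.cQ 1) (-1) hsε d.ccT hl hN1 hR hEpos j
    have eZ3 := qSum_eq_eval2_momTable hS (d.cQ 3) (-1) hsb d.ccT hl hN3 hR hEpos j
    have eZ4 := qSum_eq_eval2_momTable hS (d.cQ 4) 1 hsb d.ccT hl hN4 hR hEpos j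
    have pX := pmem2_of_subset2I (pmem2_momTableI hS (d.cQ 0) (-1) hsσ d.ccT d.l d.N d.R) cX
    have pY := pmem2_of_subset2I (pmem2_momTableI hS (d.cQ 1) (-1) hsε d.ccT d.l d.N d.R) cY
    have pZ := pmem2_of_subset2I (pmem2_add2I (pmem2_momTableI hS (d.cQ 3) (-1) hsb d.ccT d.l d.N d.R)
      (pmem2_momTableI hS (d.cQ 4) 1 hsb d.ccT d.l d.N d.R)) cZ
    have vX := halfStripPos2_sound hS pX hX hP hθ.1 (hθ.2.trans (by exact_mod_cast hθX))
    have vY := halfStripPos2_sound hS pY hY hP hθ.1 (hθ.2.trans (by exact_mod_cast hθY))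
    have vD := halfStripPosD_sound hS pX pY pZ hDall hP hθ.1 (hθ.2.trans (by exact_mod_cast hθD))
    rw [eval2_add2] at vD
    simp only [Rat.cast_neg, Rat.cast_one] at eX eY eZ3 eZ4
    have goalD : (qSum (fun ab => (d.cQ 3 ab : ℝ)) d.l.toFinset ((p.1 + p.2) / 2) (-1) E j +
        qSum (fun ab => (d.cQ 4 ab : ℝ)) d.l.toFinset ((p.1 + p.2) / 2) 1 E j) ^ 2 ≤
        4 * qSum (fun ab => (d.cQ 0 ab : ℝ)) d.l.toFinset p.1 (-1) E j *
          qSum (fun ab => (d.cQ 1 ab : ℝ)) d.l.toFinset p.2 (-1) E j := by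
      rw [eX, eY, eZ3, eZ4, sq]; linarith
    exact ⟨by rw [eX]; exact vX.le, by rw [eY]; exact vY.le, goalD⟩
  · -- BOUNDED PART: δ-expanded row triples
    have hElt : E < d.E1 := lt_of_not_ge hE1
    have hjJ : j < d.J1 + 1 := by
      have h1' : (j : ℝ) < (d.J1 : ℝ) + 1 := by
        have : ((d.E1 : ℚ) : ℝ) ≤ (d.J1 : ℝ) + 1 := by exact_mod_cast hJ1
        linarith
      exact_mod_cast h1'
    -- the three δ's
    have hδσ : |p.1 - d.σ0| ≤ d.Wσ := by
      unfold EvenRegionDataΔ.σ0 EvenRegionDataΔ.Wσ; push_cast; rw [abs_le]; constructor <;> linarith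
    have hδε : |p.2 - d.ε0| ≤ d.Wε := by
      unfold EvenRegionDataΔ.ε0 EvenRegionDataΔ.Wε; push_cast; rw [abs_le]; constructor <;> linarith
    have hδb : |(p.1 + p.2) / 2 - d.b0| ≤ d.Wb := by
      unfold EvenRegionDataΔ.b0 EvenRegionDataΔ.Wb EvenRegionDataΔ.σ0 EvenRegionDataΔ.Wσ EvenRegionDataΔ.ε0
        EvenRegionDataΔ.Wε
      push_cast; rw [abs_le]; constructor <;> linarith
    -- the four q-sums as triples
    have eX := qSum_eq_delta_rows hS (d.cQ 0) (-1) d.σ0 hWσ d.ccQ hl hZX hδσ E j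
    have eY := qSum_eq_delta_rows hS (d.cQ 1) (-1) d.ε0 hWε d.ccQ hl hZY hδε E j
    have eZ3 := qSum_eq_delta_rows hS (d.cQ 3) (-1) d.b0 hWb d.ccQ hl hZ3 hδb E j
    have eZ4 := qSum_eq_delta_rows hS (d.cQ 4) 1 d.b0 hWb d.ccQ hl hZ4 hδb E j
    have aσ : ((d.σ0 : ℚ) : ℝ) + (p.1 - d.σ0) = p.1 := by ring
    have aε : ((d.ε0 : ℚ) : ℝ) + (p.2 - d.ε0) = p.2 := by ring
    have ab : ((d.b0 : ℚ) : ℝ) + ((p.1 + p.2) / 2 - d.b0) = (p.1 + p.2) / 2 := by ring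
    rw [aσ] at eX; rw [aε] at eY; rw [ab] at eZ3 eZ4
    simp only [Rat.cast_neg, Rat.cast_one] at eX eY eZ3 eZ4
    -- memberships of the real triples in the computed triples, then in the literals
    have qX := pmem3_delta_rows hS (d.cQ 0) (-1) d.σ0 hWσ d.ccQ d.l d.N j hδσ
    have qY := pmem3_delta_rows hS (d.cQ 1) (-1) d.ε0 hWε d.ccQ d.l d.N j hδε
    have q3 := pmem3_delta_rows hS (d.cQ 3) (-1) d.b0 hWb d.ccQ d.l d.N j hδb
    have q4 := pmem3_delta_rows hS (d.cQ 4) 1 d.b0 hWb d.ccQ d.l d.N j hδb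
    have qZ := pmem3_add q3 q4
    have hrow := hr j hjJ
    simp only [EvenRegionDataΔ.rowLitOK, Bool.and_eq_true] at hrow
    obtain ⟨⟨sX, sY⟩, sZ⟩ := hrow
    have mX := pmem3_of_subset3 qX sX
    have mY := pmem3_of_subset3 qY sY
    have mZ := pmem3_of_subset3 qZ sZ
    -- locate the piece of P = E − cc
    have hmE2 : max (d.E0 : ℝ) (j : ℝ) ≤ E := max_le hE hj
    have hmE : ((max d.E0 (j : ℚ) : ℚ) : ℝ) ≤ E := by push_cast; exact hmE2
    have hm1 : max d.E0 (j : ℚ) ≤ d.E1 := by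
      have : ((max d.E0 (j : ℚ) : ℚ) : ℝ) ≤ ((d.E1 : ℚ) : ℝ) := hmE.trans hElt.le
      exact_mod_cast this
    have hw : 0 ≤ (d.E1 - max d.E0 (j : ℚ)) / (K : ℚ) := div_nonneg (by linarith) (by positivity)
    have hmono : ∀ k : ℕ, d.pieceLo K j k ≤ d.pieceLo K j (k + 1) := fun k => by
      unfold EvenRegionDataΔ.pieceLo; push_cast; nlinarith
    have e0 : d.pieceLo K j 0 = max d.E0 (j : ℚ) - d.ccQ := by unfold EvenRegionDataΔ.pieceLo; simp
    have hKq : (K : ℚ) ≠ 0 := by exact_mod_cast hK.ne'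
    have eK : d.pieceLo K j K = d.E1 - d.ccQ := by
      unfold EvenRegionDataΔ.pieceLo; field_simp; ring
    have hn1 : K - 1 + 1 = K := Nat.sub_add_cancel hK
    obtain ⟨k, hk, hk1, hk2⟩ := exists_mem_gridCell (fun k : ℕ => ((d.pieceLo K j k : ℚ) : ℝ)) (K - 1)
      (Δ := E - d.ccQ) (by show ((d.pieceLo K j 0 : ℚ) : ℝ) ≤ E - d.ccQ; rw [e0]; push_cast; linarith [hmE2])
      (by show E - d.ccQ ≤ ((d.pieceLo K j (K - 1 + 1) : ℚ) : ℝ); rw [hn1, eK]; push_cast; linarith)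
    have hkK : k < K := by omega
    have hpiece := hpc j k hjJ hkK
    simp only [EvenRegionDataΔ.pieceOK, Bool.or_eq_true, Bool.and_eq_true, decide_eq_true_eq] at hpiece
    rcases hpiece with hvac | ⟨⟨rX, rY⟩, rD⟩
    · exfalso
      have : ((d.E1 : ℚ) : ℝ) < ((max d.E0 (j : ℚ) : ℚ) : ℝ) := by exact_mod_cast hvac
      linarith
    have vX := posOn3_sound hS hWσ mX.fst mX.snd mX.thd rX hk1 hk2 hδσ
    have vY := posOn3_sound hS hWε mY.fst mY.snd mY.thd rY hk1 hk2 hδε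
    obtain ⟨-, -, vD⟩ := posOnDE3_sound hS hWσ hWε hWb mX mY mZ rD hk1 hk2 hδσ hδε hδb
    rw [val3_add] at vD
    simp only [val3] at vD
    refine ⟨?_, ?_, ?_⟩
    · rw [eX]; exact vX.le
    · rw [eY]; exact vY.le
    · rw [eX, eY, eZ3, eZ4, sq]; linarith [vD]

end Summit.CriticalPhenomena.Ising3D
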